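import Mathlib
import Summits.QuantumFields.BalabanUV.Beta.AccretiveCombesThomasAnalytic

/-!
# `Summit.QuantumFields.BalabanUV.Beta.AccretiveCombesThomasSandwich` — the `Q`-SANDWICH: unit-lattice entries
# `(Q A⁻¹ Q^*)(y,y′) = q_y^* · A⁻¹ q_{y′}` of a fine-lattice inverse from the PAIRING form of the accretive
# Combes–Thomas bound — `k`-uniform with NO pointwise (ℓ^∞) input —, their weighted row sums, and the
# (2.16)-shape bound for the sandwiched inverse FAMILY

HONEST FRAMING (page 1 of everything in this cell).  Discharging `FlowStep.BetaPertH` would make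
Bałaban's ultraviolet stability UNCONDITIONAL — a constructive-QFT result; it is NOT the continuum
limit and NOT the Clay problem.  This module discharges nothing of `BetaPertH`; [folklore] linear algebra,
kernel-checked (unit `b2b-balaban-beta-d4-p3`, road P3 «reduction road», gen 3; kernel leaf A2 of the
road's re-cut of NODE A = (T1)(i)(ii) ⇐ (T2) G-IF-10 ⇐ (T3) G-B9-10, census `BETA/REMAINDER-BETA.md` §9).
HONEST DEPENDENCY: continuum YM on T⁴ ⇐ BetaPertH ∧ nine spine estimates (0/9 proved); BetaPertH ⇐
(D1) ∧ (D4) ∧ CAP+tail; G-an2-4 gates asym, D1 and NE2/3/4.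

WHY THIS FILE.  The operators whose (2.16)-type bounds [II] = B13 (CMP 116) p. 15 consumes — `C^{(k)}(Z₀)`,
`(C*Δ_kC + x)⁻¹` of (2.7), `Δ_k` — live on the UNIT lattice and are `Q`-sandwiches of FINE-lattice inverses
(B9 (CMP 99) (3.185) `C^{(k)}(Λ) = (I + D̄μ)QG̃₂Q*(I + μ*D̄*)`, (3.174) `C′^{(k)}(Λ) = Q′𝒢̃Q′*`; the finite-range
dressing `I + D̄μ` keeps the rate: `B9Thm315Decay.dressed_decay`).  With the block average `(Qf)(y) =
Σ_{x∈B(y)} η^d f(x)` and the counting-coordinate matrix `M` of the fine operator (`M⁻¹(x,x′) = η^d G(x,x′)`),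
`(QGQ*)(y,y′) = q_y^* · M⁻¹ q_{y′}` with `q_y = η^{d/2}·1_{B(y)}`, `‖q_y‖² = η^d·n^d = 1` for EVERY `k`
(`n = L^k`, `η = n⁻¹`): the unit-lattice entry is a PAIRING of the inverse between two block-supported unit
vectors — exactly the shape of `AccretiveCombesThomas.combesThomas_of_conjCoercive`.  No pointwise (ℓ^∞,
B9 (3.42)-type) bound on the fine kernel is needed, hence no `η^{−d}` loss: the road's answer to «which norm
of the local inverses does the unit-lattice consumer actually need».  Abstract over the fine index set `X`, the
unit index set `Y`, a block map `blk : X → Y` and test vectors `q_y` supported in block `y` with `‖q_y‖² ≤ N`.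
* §1 `norm_sandwich_inv_le` — `|q_y^* A⁻¹ q_{y′}| ≤ N m⁻¹ e^{−κ D(y,y′)}` from conjugated coercivity of `A` with
  ONE constant `m` along the block-constant weights `x ↦ D(blk x, y′)` (a unit-lattice pseudo-distance `D`
  pulled back to the fine lattice; `D(y′,y′) = 0`);
* §2 `wrs_sandwich_inv` — the weighted row sums `WRS κ′ D S (N·L/m)` of the sandwich matrix
  `S(y,y′) = q_y^* A⁻¹ q_{y′}` at any smaller rate, against the unit-lattice profile `Σ_{y′} e^{−(κ−κ′)D(y,y′)} ≤ L`
  (`B13PerturbativeStep.WRS.of_entrywise` BY NAME);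
* §3 the FAMILY: for `σ ↦ A(σ)` entrywise holomorphic on `|σ| < R` and uniformly conjugated-coercive there,
  `σ ↦ S_σ(y,y′)` is holomorphic (`differentiableOn_sandwich`, from `AccretiveCombesThomasAnalytic.
  differentiableOn_inv_apply`) and END `wrs_sandwich_sub_zero`:
  `WRS κ′ D (S_σ − S_0) (2(N·L/m)/R·‖σ‖)` — the (2.16) shape for sandwiched inverse families, through
  `WRS.sub_apply_zero_of_differentiableOn` BY NAME.
WHAT IS NOT HERE: Bałaban's `Q`, `G̃₂`, `μ` themselves (the instance), the walk structure (G-IF-10 proper).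

ABSOLUTE RULE.  Nothing printed is cited as a fact; nothing of other lineages restated (BY NAME: `WRS`,
`WRS.of_entrywise`, `WRS.sub_apply_zero_of_differentiableOn`, `B5Prop11Lower.nsq`).  NOT summit progress.
-/

open scoped BigOperators Matrix ComplexConjugate
open Finset Complex Matrix Metric

namespace Summit.QuantumFields.BalabanUV.Beta.AccretiveCombesThomasSandwich

open Summit.QuantumFields.BalabanUV.Beta.AccretiveCombesThomas
open Summit.QuantumFields.BalabanUV.Beta.AccretiveCombesThomasAnalytic
open Literature.MathematicalPhysics.QuantumFieldTheory.Balaban1983to89.B5Prop11Lower (nsq nsq_nonneg)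
open Literature.MathematicalPhysics.QuantumFieldTheory.Balaban1983to89.B13PerturbativeStep (WRS)
open Literature.MathematicalPhysics.QuantumFieldTheory.Balaban1983to89
  (B13PerturbativeStep.WRS.of_entrywise B13PerturbativeStep.WRS.sub_apply_zero_of_differentiableOn)

noncomputable section

variable {X Y : Type*} [Fintype X] [DecidableEq X] [Fintype Y]

/-! ## §1 The sandwich entry from the pairing bound -/

omit [Fintype Y] in
/-- **The `Q`-sandwich entry.**  If `A` is conjugated-coercive with ONE constant `m > 0` along every block-constant
weight `x ↦ D(blk x, y′)` (rate `κ ≥ 0`, `D(y′,y′) = 0`), and the test vectors `q_y` are supported in block `y`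
with `‖q_y‖² ≤ N`, then `|q_y^* A⁻¹ q_{y′}| ≤ N m⁻¹ e^{−κ D(y,y′)}`.  (Bałaban: `q_y = η^{d/2}1_{B(y)}`, `N = 1`
for every `k`.) [folklore] -/
theorem norm_sandwich_inv_le (A : Matrix X X ℂ) (blk : X → Y) (D : Y → Y → ℝ) (hD0 : ∀ y, D y y = 0)
    (q : Y → X → ℂ) (hq : ∀ y x, blk x ≠ y → q y x = 0) {N : ℝ} (hN : ∀ y, nsq (q y) ≤ N)
    {κ m : ℝ} (hκ : 0 ≤ κ) (hm : 0 < m)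
    (hc : ∀ y', ∀ z : X → ℂ, m * nsq z ≤ (conjForm A κ (fun x => D (blk x) y') z).re) (y y' : Y) :
    ‖star (q y) ⬝ᵥ (A⁻¹ *ᵥ q y')‖ ≤ N * (Real.exp (-(κ * D y y')) / m) := by
  have hAu : IsUnit A := isUnit_of_conjCoercive hm (hc y')
  have hdet : IsUnit A.det := (Matrix.isUnit_iff_isUnit_det A).mp hAu
  have hx : A *ᵥ (A⁻¹ *ᵥ q y') = q y' := by
    rw [Matrix.mulVec_mulVec, Matrix.mul_nonsing_inv A hdet, Matrix.one_mulVec]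
  have h := combesThomas_of_conjCoercive A (fun x => D (blk x) y') hm hκ (hc y') (R := D y y')
    (u := q y) hx
    (fun x hx' => by
      by_cases hb : blk x = y
      · simp only [hb]; exact le_rfl
      · exact absurd (hq y x hb) hx')
    (fun x hx' => by
      by_cases hb : blk x = y'
      · simp only [hb, hD0]; exact le_rfl
      · exact absurd (hq y' x hb) hx')
  have hsq : Real.sqrt (nsq (q y)) * Real.sqrt (nsq (q y')) ≤ N := by
    have hN0 : 0 ≤ N := (nsq_nonneg _).trans (hN y)
    calc Real.sqrt (nsq (q y)) * Real.sqrt (nsq (q y')) ≤ Real.sqrt N * Real.sqrt N :=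
          mul_le_mul (Real.sqrt_le_sqrt (hN y)) (Real.sqrt_le_sqrt (hN y')) (Real.sqrt_nonneg _)
            (Real.sqrt_nonneg _)
      _ = N := Real.mul_self_sqrt hN0
  have hE : 0 ≤ Real.exp (-(κ * D y y')) / m := div_nonneg (Real.exp_pos _).le hm.le
  calc ‖star (q y) ⬝ᵥ (A⁻¹ *ᵥ q y')‖
      ≤ Real.exp (-(κ * D y y')) / m * (Real.sqrt (nsq (q y)) * Real.sqrt (nsq (q y'))) := h
    _ ≤ Real.exp (-(κ * D y y')) / m * N := mul_le_mul_of_nonneg_left hsq hE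
    _ = N * (Real.exp (-(κ * D y y')) / m) := mul_comm _ _

/-! ## §2 Weighted row sums of the sandwich matrix on the unit lattice -/

/-- The SANDWICH MATRIX `S(y,y′) = q_y^* A⁻¹ q_{y′}` on the unit index set. [folklore] -/
def sandwich (A : Matrix X X ℂ) (q : Y → X → ℂ) : Matrix Y Y ℂ := fun y y' => star (q y) ⬝ᵥ (A⁻¹ *ᵥ q y')

/-- **WRS of the sandwich** at any rate `κ′` with unit-lattice profile `Σ_{y′} e^{−(κ−κ′)D(y,y′)} ≤ L`:
`WRS κ′ D (sandwich A q) (N/m · L)`. [folklore] -/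
theorem wrs_sandwich_inv (A : Matrix X X ℂ) (blk : X → Y) (D : Y → Y → ℝ) (hD0 : ∀ y, D y y = 0)
    (q : Y → X → ℂ) (hq : ∀ y x, blk x ≠ y → q y x = 0) {N : ℝ} (hN0 : 0 ≤ N) (hN : ∀ y, nsq (q y) ≤ N)
    {κ κ' m L : ℝ} (hκ : 0 ≤ κ) (hm : 0 < m)
    (hc : ∀ y', ∀ z : X → ℂ, m * nsq z ≤ (conjForm A κ (fun x => D (blk x) y') z).re)
    (hL : ∀ y, ∑ y', Real.exp (-((κ - κ') * D y y')) ≤ L) :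
    WRS κ' D (sandwich A q) (N / m * L) := by
  refine B13PerturbativeStep.WRS.of_entrywise (θ := N / m) (div_nonneg hN0 hm.le) (fun y y' => ?_) hL
  have h := norm_sandwich_inv_le A blk D hD0 q hq hN hκ hm hc y y'
  calc ‖sandwich A q y y'‖ = ‖star (q y) ⬝ᵥ (A⁻¹ *ᵥ q y')‖ := rfl
    _ ≤ N * (Real.exp (-(κ * D y y')) / m) := h
    _ = N / m * Real.exp (-(κ * D y y')) := by ring

/-! ## §3 The sandwiched inverse FAMILY: holomorphy, uniform localisation, (2.16)-shape END -/

omit [Fintype Y] in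
/-- Holomorphy of the sandwich entries of an entrywise holomorphic, invertible family (finite sums of products
of constants with the holomorphic inverse entries of `AccretiveCombesThomasAnalytic.differentiableOn_inv_apply`).
[folklore] -/
theorem differentiableOn_sandwich {A : ℂ → Matrix X X ℂ} {U : Set ℂ}
    (hA : ∀ i j, DifferentiableOn ℂ (fun σ => A σ i j) U) (hU : ∀ σ ∈ U, IsUnit (A σ)) (q : Y → X → ℂ)
    (y y' : Y) : DifferentiableOn ℂ (fun σ => sandwich (A σ) q y y') U := by
  have h : (fun σ => sandwich (A σ) q y y')
      = fun σ => ∑ x, (starRingEnd ℂ) (q y x) * ∑ x', (A σ)⁻¹ x x' * q y' x' := by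
    funext σ
    simp only [sandwich, dotProduct, Matrix.mulVec, Pi.star_apply, Complex.star_def]
  rw [h]
  refine DifferentiableOn.fun_sum fun x _ => DifferentiableOn.const_mul ?_ _
  refine DifferentiableOn.fun_sum fun x' _ => ?_
  exact (differentiableOn_inv_apply hA hU x x').mul_const _

/-- **(2.16)-shape for SANDWICHED inverse families.**  `σ ↦ A(σ)` entrywise holomorphic on `|σ| < R`, uniformly
conjugated-coercive there (ONE `m`) along the block-constant weights `x ↦ D(blk x, y′)`; test vectors `q_y`
supported in block `y` with `‖q_y‖² ≤ N`; unit-lattice profile `Σ_{y′} e^{−(κ−κ′)D(y,y′)} ≤ L`.  Then for every `σ`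
in the disc `WRS κ′ D (S_σ − S_0) (2(N/m·L)/R·‖σ‖)`, `S_σ = sandwich (A σ) q` — `B13PerturbativeStep.WRS.
sub_apply_zero_of_differentiableOn` BY NAME on the unit lattice. [folklore] -/
theorem wrs_sandwich_sub_zero [Nonempty Y] {A : ℂ → Matrix X X ℂ} (blk : X → Y) (D : Y → Y → ℝ)
    (hD0 : ∀ y, D y y = 0) (q : Y → X → ℂ) (hq : ∀ y x, blk x ≠ y → q y x = 0) {N : ℝ} (hN0 : 0 ≤ N)
    (hN : ∀ y, nsq (q y) ≤ N) {κ κ' m R L : ℝ} (hR : 0 < R) (hκ : 0 ≤ κ) (hm : 0 < m)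
    (ha : ∀ i j, DifferentiableOn ℂ (fun σ => A σ i j) (ball 0 R))
    (hc : ∀ σ ∈ ball (0 : ℂ) R, ∀ y', ∀ z : X → ℂ, m * nsq z ≤ (conjForm (A σ) κ (fun x => D (blk x) y') z).re)
    (hL : ∀ y, ∑ y', Real.exp (-((κ - κ') * D y y')) ≤ L) {σ : ℂ} (hσ : σ ∈ ball (0 : ℂ) R) :
    WRS κ' D (sandwich (A σ) q - sandwich (A 0) q) (2 * (N / m * L) / R * ‖σ‖) := by
  have hU : ∀ τ ∈ ball (0 : ℂ) R, IsUnit (A τ) :=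
    fun τ hτ => isUnit_of_conjCoercive hm (hc τ hτ (Classical.arbitrary Y))
  have ha' : ∀ y y', DifferentiableOn ℂ (fun τ => sandwich (A τ) q y y') (ball 0 R) :=
    fun y y' => differentiableOn_sandwich ha hU q y y'
  have hm' : ∀ τ ∈ ball (0 : ℂ) R, ∀ y y', ‖sandwich (A τ) q y y'‖ ≤ N / m * Real.exp (-(κ * D y y')) := by
    intro τ hτ y y'
    have h := norm_sandwich_inv_le (A τ) blk D hD0 q hq hN hκ hm (hc τ hτ) y y'
    calc ‖sandwich (A τ) q y y'‖ = ‖star (q y) ⬝ᵥ ((A τ)⁻¹ *ᵥ q y')‖ := rfl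
      _ ≤ N * (Real.exp (-(κ * D y y')) / m) := h
      _ = N / m * Real.exp (-(κ * D y y')) := by ring
  have hρ : ∀ y, ∑ y', N / m * Real.exp (-(κ * D y y')) * Real.exp (κ' * D y y') ≤ N / m * L := by
    intro y
    calc ∑ y', N / m * Real.exp (-(κ * D y y')) * Real.exp (κ' * D y y')
        = N / m * ∑ y', Real.exp (-((κ - κ') * D y y')) := by
          rw [Finset.mul_sum]
          refine Finset.sum_congr rfl fun y' _ => ?_
          rw [mul_assoc, ← Real.exp_add]
          ring_nf
      _ ≤ N / m * L := mul_le_mul_of_nonneg_left (hL y) (div_nonneg hN0 hm.le)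
  exact B13PerturbativeStep.WRS.sub_apply_zero_of_differentiableOn (A := fun τ => sandwich (A τ) q) hR ha' hm'
    hρ hσ

end

end Summit.QuantumFields.BalabanUV.Beta.AccretiveCombesThomasSandwich
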